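import Mathlib
import Summits.NavierStokesRegularity.NavierStokesRegularity.Theorems.WakeRatchetTailRatchetTruncatedPositivity
import HarnessLib

/-!
# `WakeRatchet.TailRatchet` (stmt-NavierStokesRegularity-21808): invariance of the LEADING-EDGE box of the
# truncated dyadic one-period map (brick R1b of the stub-A analogue)

Support file for the crux `TailRatchet` (route `WakeRatchet`; MODEL lattice ODEs of Tao 2016 §4 —
nothing here is a statement about the Navier–Stokes equations).  After the reduction files of this line
(`…LatticePeriod`, `…TruncationLimit`, `…TruncatedFlow`, `…InvariantBox`, `…WakeEnvelope`, `…SharpWake`,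
`…ConjugateBox`) the construction blocking stmt-21808 is an invariant set of the one-period map of the
`K`-truncated dyadic lattice.  Ahead of the front the shells are doubly-exponentially small; this file
proves that part of the box takes care of itself, uniformly in `K`:

* `leadingEdge_le_two_mul` — non-negative data with `Z_n(0) ≤ u_n` (`n ≥ N`) and the last core shell
  controlled over the period (`Z_{N-1}² ≤ m` on `[0,T']`) give `Z_n(t) ≤ 2u_n` on `[0,T']` for all `n ≥ N`
  under the feed conditions `Λ^{N-1} m T' ≤ u_N`, `Λ^n (2u_n)² T' ≤ u_{n+1}` (induction on the shell with
  `truncated_le_feed`; the drain is non-negative by `truncated_nonneg`);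
* `leadingEdge_onePeriod_mem` — hence, if `2u_{n+1} ≤ c u_n` (`u` geometric with ratio `≤ c/2`,
  `c = (1+T)/Λ`), the one-period image `c⁻¹ Z_{n+1}(T)` lies in `[0, u_n]` for every `n ≥ N`: the
  leading-edge box `∏_{n≥N}[0,u_n]` is mapped into itself given only the core bound `m`.

HONEST FRAMING: elementary estimates for a finite-dimensional MODEL ODE; no registered stub is closed, no
summit statement is touched.
-/

noncomputable section

set_option linter.dupNamespace false

namespace Summit.NavierStokesRegularity.NavierStokesRegularity.Theorems

namespace WakeRatchetLatticePeriod

open Set Filter Topology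

/-- **Leading-edge envelope over one period (R1b of the box).**  Non-negative data of the `K`-truncated
dyadic lattice whose shells `n ≥ N` start below an envelope `u_n`, with the last core shell controlled over
the period (`Z_{N-1}² ≤ m` on `[0,T']`), stay below `2u_n` on `[0,T']` for all `n ≥ N`, provided the feed
conditions `Λ^{N-1} m T' ≤ u_N` and `Λ^n (2u_n)² T' ≤ u_{n+1}` (`n ≥ N`) hold — e.g. for a geometric
`u_n = u_N rⁿ⁻ᴺ` as soon as `u_N` is small against `r/(4Λ^N T')`; induction on the shell with
`truncated_le_feed` (the drain is non-negative by `truncated_nonneg`).  Uniform in `K`.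
[cite: Tao2016AveragedNS, §1.2; elementary] -/
theorem leadingEdge_le_two_mul {L : ℝ} {K : ℕ} {T' : ℝ} {Z : ℤ → ℝ → ℝ}
    (hD : ∀ n : ℤ, |n| ≤ (K : ℤ) → ∀ t ∈ Icc (0 : ℝ) T', HasDerivWithinAt (Z n)
      (L ^ (n - 1) * Z (n - 1) t ^ 2 - L ^ n * Z n t * Z (n + 1) t) (Icc (0 : ℝ) T') t)
    (hzero : ∀ n : ℤ, (K : ℤ) < |n| → ∀ t ∈ Icc (0 : ℝ) T', Z n t = 0)
    (hL : 0 ≤ L) (h0 : ∀ n : ℤ, 0 ≤ Z n 0) (hT' : 0 ≤ T') {N : ℤ} {u : ℤ → ℝ} {m : ℝ}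
    (hx : ∀ n : ℤ, N ≤ n → Z n 0 ≤ u n)
    (hm : ∀ t ∈ Icc (0 : ℝ) T', Z (N - 1) t ^ 2 ≤ m)
    (hbase : L ^ (N - 1) * m * T' ≤ u N)
    (hstep : ∀ n : ℤ, N ≤ n → L ^ n * (2 * u n) ^ 2 * T' ≤ u (n + 1)) :
    ∀ n : ℤ, N ≤ n → ∀ t ∈ Icc (0 : ℝ) T', Z n t ≤ 2 * u n := by
  -- induction on `n = N + k`
  have key : ∀ k : ℕ, ∀ t ∈ Icc (0 : ℝ) T', Z (N + k) t ≤ 2 * u (N + k) := by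
    intro k
    induction k with
    | zero =>
      intro t ht
      simp only [CharP.cast_eq_zero, add_zero]
      have hm0 : 0 ≤ m := (sq_nonneg _).trans (hm 0 ⟨le_rfl, hT'⟩)
      have hfeed := truncated_le_feed hD hzero hL h0 N ht (M := m)
        (fun s hs => hm s ⟨hs.1, hs.2.trans ht.2⟩)
      have h1 : L ^ (N - 1) * m * t ≤ L ^ (N - 1) * m * T' :=
        mul_le_mul_of_nonneg_left ht.2 (mul_nonneg (zpow_nonneg hL _) hm0)
      have h2 := hx N le_rfl
      linarith
    | succ k ih =>
      intro t ht
      have hNk : N ≤ N + k := by omega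
      have hsq : ∀ s ∈ Icc (0 : ℝ) t, Z (N + (k + 1 : ℕ) - 1) s ^ 2 ≤ (2 * u (N + k)) ^ 2 := by
        intro s hs
        have hs' : s ∈ Icc (0 : ℝ) T' := ⟨hs.1, hs.2.trans ht.2⟩
        rw [show N + ((k + 1 : ℕ) : ℤ) - 1 = N + k by push_cast; ring]
        have hZ0 : 0 ≤ Z (N + k) s := truncated_nonneg hD hzero hL h0 _ s hs'
        exact pow_le_pow_left₀ hZ0 (ih s hs') 2
      have hfeed := truncated_le_feed hD hzero hL h0 (N + (k + 1 : ℕ)) ht (M := (2 * u (N + k)) ^ 2) hsq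
      have hst := hstep (N + k) hNk
      have hidx : N + ((k + 1 : ℕ) : ℤ) = N + k + 1 := by push_cast; ring
      rw [hidx] at hfeed ⊢
      rw [show N + (k : ℤ) + 1 - 1 = N + k by ring] at hfeed
      have h1 : L ^ (N + k) * (2 * u (N + k)) ^ 2 * t ≤ L ^ (N + k) * (2 * u (N + k)) ^ 2 * T' :=
        mul_le_mul_of_nonneg_left ht.2 (mul_nonneg (zpow_nonneg hL _) (sq_nonneg _))
      have h2 := hx (N + k + 1) (by omega)
      linarith
  intro n hn t ht
  obtain ⟨k, rfl⟩ : ∃ k : ℕ, n = N + k := ⟨(n - N).toNat, by omega⟩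
  exact key k t ht

/-- **The leading-edge box is mapped into itself by the one-period map.**  Under the conclusion of
`leadingEdge_le_two_mul` and the ratio condition `2 u_{n+1} ≤ c u_n` (e.g. `u` geometric with ratio
`≤ c/2`), the rescaled shifted state `c⁻¹ Z_{n+1}(T)` lies in `[0, u_n]` for every `n ≥ N`. [elementary] -/
theorem leadingEdge_onePeriod_mem {L : ℝ} {K : ℕ} {T' : ℝ} {Z : ℤ → ℝ → ℝ}
    (hD : ∀ n : ℤ, |n| ≤ (K : ℤ) → ∀ t ∈ Icc (0 : ℝ) T', HasDerivWithinAt (Z n)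
      (L ^ (n - 1) * Z (n - 1) t ^ 2 - L ^ n * Z n t * Z (n + 1) t) (Icc (0 : ℝ) T') t)
    (hzero : ∀ n : ℤ, (K : ℤ) < |n| → ∀ t ∈ Icc (0 : ℝ) T', Z n t = 0)
    (hL : 0 ≤ L) (h0 : ∀ n : ℤ, 0 ≤ Z n 0) {N : ℤ} {u : ℤ → ℝ} {c T : ℝ} (hc : 0 < c)
    (hT : T ∈ Icc (0 : ℝ) T')
    (henv : ∀ n : ℤ, N ≤ n → ∀ t ∈ Icc (0 : ℝ) T', Z n t ≤ 2 * u n)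
    (hratio : ∀ n : ℤ, N ≤ n → 2 * u (n + 1) ≤ c * u n) :
    ∀ n : ℤ, N ≤ n → 0 ≤ c⁻¹ * Z (n + 1) T ∧ c⁻¹ * Z (n + 1) T ≤ u n := by
  intro n hn
  have hZ0 : 0 ≤ Z (n + 1) T := truncated_nonneg hD hzero hL h0 _ T hT
  refine ⟨mul_nonneg (inv_nonneg.2 hc.le) hZ0, ?_⟩
  rw [inv_mul_le_iff₀ hc]
  exact (henv (n + 1) (by omega) T hT).trans (hratio n hn)

end WakeRatchetLatticePeriod

end Summit.NavierStokesRegularity.NavierStokesRegularity.Theorems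

end
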